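import Summits.BirchSwinnertonDyer.BirchSwinnertonDyer.Theorems.AlignedTransportAtTwoMainConjectureTransportAlignedAtTwoKilfordCopyKernelAlgebra
import Summits.BirchSwinnertonDyer.BirchSwinnertonDyer.Theorems.AlignedTransportAtTwoMainConjectureTransportAlignedAtTwoKilfordCopyTransport
import Summits.BirchSwinnertonDyer.Rank1Residual.F1Sign2.CopyAlignmentAtTwo
import Literature.NumberTheory.EllipticCurves.ModularJacobianMultiplicityOneCosocleProofs
import Literature.NumberTheory.EllipticCurves.PeriodHomologyIntersectionPairing
import HarnessLib

/-!
# Crux C1 `MainConjectureTransportAlignedAtTwo` (stmt-BirchSwinnertonDyer-22296), line `birth`, residual (R2) `stub_lamLawKilford` (Kilford stratum):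
# COPY ↔ KERNEL — the half-class kernel of a modular parametrisation on `J₀(N)[2]` IS the orthogonal of the cell's `twoTorsionCopy` under the
# Hecke-self-adjoint perfect pairing on `H₁(X₀(N);ℤ)`; hence SAME COPY ⟹ SAME KERNEL (width seat att-p3 g16; `--supports 22296`)

THEOREMS ONLY (no `def`, no `sorry`, no named fact). CONDITIONAL on: a carrier `J : ModularJacobianGaloisData N ι` (typed T1), a perfect
Hecke-self-adjoint pairing `B` on `Λ = periodHomologyHecke N` (the tree's IP `periodHomology_exists_heckeSelfAdjoint_perfectPairing`, a THEOREM of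
cell bsd-wall: `…ThetaLayerLambdaCongruenceAtTwo.ip_of_crossingPairing_flagSides`; taken here as data `B, hB, hadj` / hypothesis `hIP`), the
non-vanishing `hnz` of the Jacobi map on some half-class (in the crux's context: the `μ = 0` theorem, `…KilfordCopyNegDisc.exists_jacobiMap_half_ne_zero_of_Δ_neg`
/ `…DeltaPosCongruenceInputs.exists_jacobiMap_half_ne_zero`), and ONE rank statement **RANK2** `finrank_ℤ Λ[I_f] ≤ 2` for the Hecke annihilator
`I_f = F1Sign2.heckeAnnihilator f` of the datum's newform (PRINT: Shimura's `dim A_f = [K_f:ℚ] = 1`, Darmon–Diamond–Taylor 1995 §1.7, Cremona 1997 §2.8 —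
`Λ[I_f] = H₁(X₀(N);ℤ)[I_f]` is the rank-two period lattice of the optimal curve; carried INLINE, in kernel form, as a hypothesis). BSD is not proved by
this; C1 is not closed by this; `stub_lamLawKilford` is NOT discharged by this.

WHY (KILFORD-COPY-att-p3-g15.md §4, PRINT-FOLD-att-p4-g15.md §5: «COPY↔KERNEL bridge — dead end: needs the intersection pairing / the `f`-isotypic
decomposition»). The cell's typed candidate `F1Sign2.CopyAlignmentAtTwo` (-imc H12♯; REF1 §34; census H12 10/10, P14, PLANES 15/15) speaks of the COPY
`twoTorsionCopy f = ½Λ[I_f]/Λ ⊆ J₀(N)[2]`; the (R2) capstones (`…KilfordCopyNegDisc.lamLawKilford_of_conductorNorm_eq_of_ker_iff`, p674335) consume the KERNEL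
`{x ∈ Λ | D.jacobiMap [x/2] = 0}`. This file proves they determine each other:

* §1 `exists_theta` — the Jacobi map on half-classes as an additive SURJECTION `θ : Λ ↠ W[2](ℚ̄)` (Galois: att-p1 g10's
  `surjective_of_equivariant_of_exists_ne_zero`; needs `J`, `E(ℚ)[2] = 0` in abscissa form, `hnz`).
* §2 `finrank_quotient_evalKer` — `finrank_ℤ (Λ / ker ev_f) = 2` (`≤ 2`: `c·Λ_f ⊆ Λ_E = ℤω₁ ⊕ ℤω₂`; `≥ 2`: `θ` factors through `(Λ/ker ev_f)/2 ↠ W[2]`, `#W[2] = 4`).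
* §3 **`jacobiMap_half_eq_zero_iff_forall_dvd`** — `D.jacobiMap [y/2] = 0 ⟺ ∀ x ∈ Λ[I_f], 2 ∣ B(x, y)`: the kernel is the `B`-orthogonal of the copy
  (`…KilfordCopyKernelAlgebra.mem_add_smul_iff_forall_dvd` with `K = ker ev_f`, `T = Λ[I_f]`; `ker θ = K + 2Λ` by `…exists_mem_add_smul_of_apply_eq_zero`).
* §4 `forall_dvd_iff_of_twoTorsionCopy_eq` — equal copies have equal orthogonals (elementary: `[x₁/2] = [x₂/2] ⟹ x₁ − x₂ ∈ 2Λ`);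
  **`ker_iff_of_twoTorsionCopy_eq`** — SAME COPY ⟹ SAME KERNEL: the hypothesis `hker` of the (R2) capstones from `twoTorsionCopy D₁.f = twoTorsionCopy D₂.f`.

References: H. Darmon, F. Diamond, R. Taylor, Fermat's Last Theorem (1995) §1.3, §1.6 Lemma 1.38, §1.7 [DarmonDiamondTaylor1995]; J. E. Cremona,
Algorithms for modular elliptic curves (1997) §2.8, §2.10 [CremonaAlgorithms1997]; L. Merel (1995) §1.2–2.3 [Merel1995Homologie]; L. J. P. Kilford,
G. Wiese (2008) Question 1.9 [KilfordWiese2008].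
-/

noncomputable section

-- justification: the `Summit.BirchSwinnertonDyer.BirchSwinnertonDyer.…` path repeats a component (route-file convention)
set_option linter.dupNamespace false
set_option autoImplicit false

open scoped MatrixGroups ModularForm NumberField Classical
open CongruenceSubgroup Complex WeierstrassCurve IsDedekindDomain Polynomial Module Function
open Literature.NumberTheory.EllipticCurves Literature.NumberTheory.EllipticCurves.ModularForms
open Literature.NumberTheory.EllipticCurves.Greenberg1999
open Summit.BirchSwinnertonDyer.Rank1Residual.F1Sign2
open Summit.BirchSwinnertonDyer.BirchSwinnertonDyer.Theorems.AlignedTransportAtTwoDeltaPosGaloisPlane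
open Summit.BirchSwinnertonDyer.BirchSwinnertonDyer.Theorems.AlignedTransportAtTwoDeltaPosJacobian
open Summit.BirchSwinnertonDyer.BirchSwinnertonDyer.Theorems.AlignedTransportAtTwoKilfordCopyKernelAlgebra

namespace Summit.BirchSwinnertonDyer.BirchSwinnertonDyer.Theorems.AlignedTransportAtTwoKilfordCopyKernel

variable {N : ℕ} [NeZero N]

/-! ## §1 The Jacobi map on half-classes as a surjection `Λ ↠ W[2](ℚ̄)` -/

/-- **The half-class Jacobi map as an additive surjection onto `W[2](ℚ̄)`.** For a parametrisation datum `D` of `W` at level `N`, a `ℚ`-structure carrier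
`J`, `W` without rational `2`-torsion abscissa and `D.jacobiMap` non-zero on some half-class: there is an additive `θ : Λ → W[2](ℚ̄)` with
`ι (θ y) = D.jacobiMap [y/2]`, and `θ` is ONTO (its image is a non-zero `Γ_ℚ`-stable subgroup of the irreducible `W[2]`).
[cite: DarmonDiamondTaylor1995, §1.5 and §1.7] [cite: SilvermanAEC2009, III.§7] -/
theorem exists_theta (ι : AlgebraicClosure ℚ →+* ℂ) (J : ModularJacobianGaloisData N ι)
    {W : WeierstrassCurve ℚ} [W.IsElliptic] (D : ModularParametrizationData W N) (ht : ∀ x : ℚ, ¬ HasRationalTwoTorsionX W x)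
    (hnz : ∃ x ∈ periodHomology N, D.jacobiMap (Submodule.Quotient.mk ((2 : ℂ)⁻¹ • x)) ≠ 0) :
    ∃ θ : periodHomologyHecke N →+ geomTorsion W (2 : ℤ),
      (∀ y : periodHomologyHecke N, W.geomPointsToComplex ι (θ y : W.geomPoints) =
        D.jacobiMap (Submodule.Quotient.mk ((2 : ℂ)⁻¹ • (y : Module.Dual ℂ (CuspForm (Gamma0 N) 2))))) ∧
      (∀ y : periodHomologyHecke N, θ y = 0 ↔
        D.jacobiMap (Submodule.Quotient.mk ((2 : ℂ)⁻¹ • (y : Module.Dual ℂ (CuspForm (Gamma0 N) 2)))) = 0) ∧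
      Function.Surjective θ := by
  set Λ := periodHomologyHecke N with hΛ
  let half : Module.Dual ℂ (CuspForm (Gamma0 N) 2) → J0 N := fun z ↦ Submodule.Quotient.mk ((2 : ℂ)⁻¹ • z)
  have half_add : ∀ z z', half (z + z') = half z + half z' := fun z z' ↦ by
    simp only [half, smul_add, Submodule.Quotient.mk_add]
  have hmem : ∀ z : Λ, (z : Module.Dual ℂ (CuspForm (Gamma0 N) 2)) ∈ periodHomology N := fun z ↦ z.2
  have hex : ∀ z : Λ, ∃! P : geomTorsion W (2 : ℤ), W.geomPointsToComplex ι (P : W.geomPoints) = D.jacobiMap (half z) :=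
    fun z ↦ existsUnique_geomTorsion_eq W ι (jacobiMap_half_add_self D (hmem z))
  choose θf hθf using fun z ↦ (hex z).exists
  have uniq : ∀ (z : Λ) (P : geomTorsion W (2 : ℤ)), W.geomPointsToComplex ι (P : W.geomPoints) = D.jacobiMap (half z) → P = θf z :=
    fun z P hP ↦ (hex z).unique hP (hθf z)
  let θ : Λ →+ geomTorsion W (2 : ℤ) :=
    { toFun := θf
      map_zero' := by
        symm; apply uniq
        have h0 : half 0 = 0 := by simp only [half, smul_zero, Submodule.Quotient.mk_zero]
        rw [ZeroMemClass.coe_zero, map_zero, ZeroMemClass.coe_zero, h0, map_zero]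
      map_add' := fun z z' ↦ by
        symm; apply uniq
        rw [AddSubgroup.coe_add, map_add, hθf, hθf, Submodule.coe_add, half_add, map_add] }
  have hθ_apply : ∀ z, θ z = θf z := fun _ ↦ rfl
  -- the torsion points `⟨half z⟩ ∈ J0.tors N` and the lifted Galois action on `Λ`
  have htors : ∀ z : Λ, half z ∈ J0.tors N := fun z ↦ by
    rw [J0.mem_tors_iff, isOfFinAddOrder_iff_nsmul_eq_zero]
    exact ⟨2, two_pos, by rw [two_nsmul]; exact half_add_half_eq_zero (hmem z)⟩
  have hlift : ∀ (σ : Field.absoluteGaloisGroup ℚ) (z : Λ), ∃ z' : Λ,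
      half z' = ((J.galAct σ ⟨half z, htors z⟩ : J0.tors N) : J0 N) := by
    intro σ z
    set t : J0.tors N := J.galAct σ ⟨half z, htors z⟩ with ht'
    have htt : (t : J0 N) + (t : J0 N) = 0 := by
      rw [← Submodule.coe_add, ht', ← map_add]
      have : (⟨half z, htors z⟩ : J0.tors N) + ⟨half z, htors z⟩ = 0 := Subtype.ext (half_add_half_eq_zero (hmem z))
      rw [this, map_zero, Submodule.coe_zero]
    obtain ⟨z', hz', hz'eq⟩ := exists_half_eq htt
    exact ⟨⟨z', hz'⟩, hz'eq⟩
  choose act hact using hlift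
  have hθeq : ∀ (σ : Field.absoluteGaloisGroup ℚ) (z : Λ), θ (act σ z) = σ • θ z := by
    intro σ z
    symm
    rw [hθ_apply, hθ_apply]
    apply uniq
    rw [AddSubgroup.torsionBy.coe_smul, hact σ z]
    exact (J.jacobiMap_galAct W D σ ⟨half z, htors z⟩ (θf z : W.geomPoints) (hθf z).symm).symm
  have h0 : ∃ z, θ z ≠ 0 := by
    obtain ⟨z, hz, hne⟩ := hnz
    refine ⟨⟨z, hz⟩, fun h ↦ hne ?_⟩
    have := hθf ⟨z, hz⟩
    rw [← hθ_apply, h, ZeroMemClass.coe_zero, map_zero] at this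
    exact this.symm
  have hkerθ : ∀ y : Λ, θ y = 0 ↔ D.jacobiMap (half y) = 0 := by
    intro y
    constructor
    · intro h
      have := hθf y
      rw [← hθ_apply, h, ZeroMemClass.coe_zero, map_zero] at this
      exact this.symm
    · intro h
      rw [hθ_apply]; symm; apply uniq
      rw [ZeroMemClass.coe_zero, map_zero]; exact h.symm
  exact ⟨θ, fun y ↦ hθf y, hkerθ, surjective_of_equivariant_of_exists_ne_zero ht act θ hθeq h0⟩

/-- A geometric `2`-torsion point is killed by `2`. [folklore] -/
theorem two_nsmul_geomTorsion_two {W : WeierstrassCurve ℚ} (P : geomTorsion W (2 : ℤ)) : 2 • P = 0 :=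
  Subtype.ext (by
    rw [AddSubgroup.coe_nsmul, two_nsmul, ZeroMemClass.coe_zero]
    exact Literature.NumberTheory.EllipticCurves.DokchitserDokchitser2012.coe_add_self_eq_zero W P)

/-! ## §2 The evaluation kernel `ker ev_f ≤ Λ` and the rank of `Λ / ker ev_f` -/

section Kernel

variable {W : WeierstrassCurve ℚ} [W.IsElliptic] (D : ModularParametrizationData W N)

omit [W.IsElliptic] in
/-- A non-zero Jacobi map on some half-class forces `c ≠ 0`. [folklore] -/
theorem c_ne_zero_of_hnz (hnz : ∃ x ∈ periodHomology N, D.jacobiMap (Submodule.Quotient.mk ((2 : ℂ)⁻¹ • x)) ≠ 0) : D.c ≠ 0 := by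
  rintro hc
  obtain ⟨x, -, hne⟩ := hnz
  apply hne
  rw [jacobiMap_half_eq, hc, Int.cast_zero, zero_mul, zero_div, map_zero]

omit [W.IsElliptic] in
/-- **The half-class kernel contains `ker ev_f + 2Λ`**: if `y = k + 2z` in `Λ` with `k(f) = 0`, then `D.jacobiMap [y/2] = u_W(c·k(f)/2) + u_W(c·z(f)) = O`.
[cite: CremonaAlgorithms1997, §2.10] -/
theorem jacobiMap_half_eq_zero_of_mem_add_two {y k z : periodHomologyHecke N}
    (hk : (k : Module.Dual ℂ (CuspForm (Gamma0 N) 2)) D.f = 0) (hy : y = k + (2 : ℤ) • z) :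
    D.jacobiMap (Submodule.Quotient.mk ((2 : ℂ)⁻¹ • (y : Module.Dual ℂ (CuspForm (Gamma0 N) 2)))) = 0 := by
  subst hy
  have h2 : (2 : ℂ)⁻¹ • ((↑(k + (2 : ℤ) • z) : Module.Dual ℂ (CuspForm (Gamma0 N) 2))) =
      (2 : ℂ)⁻¹ • (k : Module.Dual ℂ (CuspForm (Gamma0 N) 2)) + (z : Module.Dual ℂ (CuspForm (Gamma0 N) 2)) := by
    rw [Submodule.coe_add, Submodule.coe_smul_of_tower, smul_add, ← Int.cast_smul_eq_zsmul ℂ, smul_smul]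
    norm_num
  rw [h2, Submodule.Quotient.mk_add, map_add, jacobiMap_half_eq, hk, mul_zero, zero_div, map_zero, zero_add,
    (Submodule.Quotient.mk_eq_zero _).mpr z.2, map_zero]

/-- **`finrank_ℤ (Λ / ker ev_f) = 2`** for the evaluation `ev_f : x ↦ c·x(f) ∈ Λ_E` (`c ≠ 0`): `≤ 2` because `Λ/ker ≅ c·Λ_f ≤ Λ_E = ℤω₁ + ℤω₂`; `≥ 2` because
the surjection `θ : Λ ↠ W[2]` (§1) kills `ker ev_f` and `2Λ`, so `#W[2] = 4 ≤ 2 ^ finrank (Λ/ker)`. Stated for any `ℤ`-linear `g : Λ → Λ_E` with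
`g y = c·y(f)`. [cite: CremonaAlgorithms1997, §2.8 and §2.10] -/
theorem finrank_quotient_evalKer
    (g : periodHomologyHecke N →ₗ[ℤ] D.L.lattice)
    (hg : ∀ y : periodHomologyHecke N, (g y : ℂ) = (D.c : ℂ) * (y : Module.Dual ℂ (CuspForm (Gamma0 N) 2)) D.f)
    (hc : D.c ≠ 0)
    (θ : periodHomologyHecke N →+ geomTorsion W (2 : ℤ))
    (hθ : ∀ y : periodHomologyHecke N, θ y = 0 ↔
        D.jacobiMap (Submodule.Quotient.mk ((2 : ℂ)⁻¹ • (y : Module.Dual ℂ (CuspForm (Gamma0 N) 2)))) = 0)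
    (hθs : Function.Surjective θ) :
    Module.finrank ℤ (periodHomologyHecke N ⧸ LinearMap.ker g) = 2 := by
  haveI := moduleFinite_int_periodHomologyHecke N
  haveI := moduleFree_int_periodHomologyHecke N
  apply le_antisymm
  · -- `Λ / ker g ≅ range g ≤ Λ_E = span {ω₁, ω₂}`
    haveI : Module.Finite ℤ D.L.lattice := Module.Finite.span_of_finite ℤ (Set.toFinite _)
    have hL : Module.finrank ℤ D.L.lattice ≤ 2 := by
      have h := finrank_span_finset_le_card (R := ℤ) (M := ℂ) ({D.L.ω₁, D.L.ω₂} : Finset ℂ)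
      rw [Finset.coe_pair] at h
      exact h.trans Finset.card_le_two
    exact (le_of_eq (LinearMap.quotKerEquivRange g).finrank_eq).trans ((Submodule.finrank_le _).trans hL)
  · -- `θ` kills `ker g` and `2Λ`, and is onto a group of order `4`
    have hKsat : ∀ (n : ℤ) (y : periodHomologyHecke N), n ≠ 0 → n • y ∈ LinearMap.ker g → y ∈ LinearMap.ker g := by
      intro n y hn hny
      rw [LinearMap.mem_ker] at hny ⊢
      rw [map_zsmul] at hny
      exact (smul_eq_zero.mp hny).resolve_left hn
    have hθK : ∀ k ∈ LinearMap.ker g, θ k = 0 := by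
      intro k hk
      rw [LinearMap.mem_ker] at hk
      have hk0 : (D.c : ℂ) * (k : Module.Dual ℂ (CuspForm (Gamma0 N) 2)) D.f = 0 := by
        rw [← hg, hk, ZeroMemClass.coe_zero]
      have hkf : (k : Module.Dual ℂ (CuspForm (Gamma0 N) 2)) D.f = 0 :=
        (mul_eq_zero.mp hk0).resolve_left (Int.cast_ne_zero.mpr hc)
      exact (hθ k).mpr (jacobiMap_half_eq_zero_of_mem_add_two D (k := k) (z := 0) hkf (by rw [smul_zero, add_zero]))
    have h4 := natCard_le_pow_finrank_quotient (LinearMap.ker g) hKsat 2 two_nsmul_geomTorsion_two θ hθK hθs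
    rw [Summit.BirchSwinnertonDyer.BirchSwinnertonDyer.Theorems.AlignedTransportAtTwoRhombicOfNegDisc.natCard_geomTorsion_two,
      show (4 : ℕ) = 2 ^ 2 by norm_num] at h4
    exact (pow_le_pow_iff_right₀ (by norm_num : (1 : ℕ) < 2)).mp h4

end Kernel

/-! ## §3 COPY ↔ KERNEL: the half-class kernel is the orthogonal of `Λ[I_f]` -/

/-- **COPY ↔ KERNEL.** `Λ = H₁(X₀(N);ℤ)` with a perfect Hecke-self-adjoint pairing `B`; a carrier `J`; a parametrisation datum `D` of a curve `W` without
rational `2`-torsion abscissa, non-zero on some half-class; and RANK2 `finrank_ℤ Λ[I_f] ≤ 2` for `I_f` the Hecke annihilator of `f = D.f`. THEN for every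
`y ∈ Λ`: `D.jacobiMap [y/2] = O ⟺ B(x, y)` is EVEN for every `I_f`-torsion `x ∈ Λ` — the half-class kernel is the orthogonal, for `B mod 2` on
`Λ/2Λ ≅ J₀(N)[2]`, of the copy `½Λ[I_f]/Λ = twoTorsionCopy f` (the Weil/intersection-pairing adjunction `ker π_* = (im π^*)^⊥`).
[cite: DarmonDiamondTaylor1995, §1.6 Lemma 1.38 and §1.7] [cite: CremonaAlgorithms1997, §2.8 and §2.10] -/
theorem jacobiMap_half_eq_zero_iff_forall_dvd
    (B : periodHomologyHecke N →+ periodHomologyHecke N →+ ℤ) (hB : Function.Bijective B)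
    (hadj : ∀ (t : HeckeRing0 N 2) (x y : periodHomologyHecke N), B (t • x) y = B x (t • y))
    (ι : AlgebraicClosure ℚ →+* ℂ) (J : ModularJacobianGaloisData N ι)
    {W : WeierstrassCurve ℚ} [W.IsElliptic] (D : ModularParametrizationData W N) (ht : ∀ x : ℚ, ¬ HasRationalTwoTorsionX W x)
    (hnz : ∃ x ∈ periodHomology N, D.jacobiMap (Submodule.Quotient.mk ((2 : ℂ)⁻¹ • x)) ≠ 0)
    (hR2 : Module.finrank ℤ
      ((Submodule.torsionBySet (HeckeRing0 N 2) (periodHomologyHecke N) (heckeAnnihilator D.f : Set (HeckeRing0 N 2))).restrictScalars ℤ) ≤ 2)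
    (y : periodHomologyHecke N) :
    D.jacobiMap (Submodule.Quotient.mk ((2 : ℂ)⁻¹ • (y : Module.Dual ℂ (CuspForm (Gamma0 N) 2)))) = 0 ↔
      ∀ x : periodHomologyHecke N, (∀ t ∈ heckeAnnihilator D.f, t • x = 0) → (2 : ℤ) ∣ B x y := by
  haveI := moduleFinite_int_periodHomologyHecke N
  haveI := moduleFree_int_periodHomologyHecke N
  have hc := c_ne_zero_of_hnz D hnz
  obtain ⟨θ, -, hθ, hθs⟩ := exists_theta ι J D ht hnz
  -- the evaluation `g : Λ → Λ_E`, `y ↦ c·y(f)`, and its kernel `K`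
  let g : periodHomologyHecke N →ₗ[ℤ] D.L.lattice :=
    { toFun := fun y ↦ ⟨(D.c : ℂ) * (y : Module.Dual ℂ (CuspForm (Gamma0 N) 2)) D.f,
        Summit.BirchSwinnertonDyer.BirchSwinnertonDyer.Theorems.AlignedTransportAtTwoDeltaPosFunctional.maninConstant_mul_eval_mem D y.2⟩
      map_add' := fun y y' ↦ by
        apply Subtype.ext
        simp only [Submodule.coe_add, LinearMap.add_apply, mul_add]
      map_smul' := fun n y ↦ by
        apply Subtype.ext
        simp only [Submodule.coe_smul_of_tower, LinearMap.smul_apply, RingHom.id_apply, zsmul_eq_mul]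
        ring }
  have hg : ∀ y : periodHomologyHecke N, (g y : ℂ) = (D.c : ℂ) * (y : Module.Dual ℂ (CuspForm (Gamma0 N) 2)) D.f := fun _ ↦ rfl
  set K : Submodule ℤ (periodHomologyHecke N) := LinearMap.ker g with hKdef
  have hKmem : ∀ y : periodHomologyHecke N, y ∈ K ↔ (y : Module.Dual ℂ (CuspForm (Gamma0 N) 2)) D.f = 0 := by
    intro y
    rw [hKdef, LinearMap.mem_ker, ← Subtype.coe_inj, hg, ZeroMemClass.coe_zero, mul_eq_zero, or_iff_right (Int.cast_ne_zero.mpr hc)]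
  have hKsat : ∀ (n : ℤ) (y : periodHomologyHecke N), n ≠ 0 → n • y ∈ K → y ∈ K := by
    intro n y hn hny
    rw [hKmem] at hny ⊢
    rw [Submodule.coe_smul_of_tower, ← Int.cast_smul_eq_zsmul ℂ, LinearMap.smul_apply, smul_eq_mul, mul_eq_zero] at hny
    exact hny.resolve_left (Int.cast_ne_zero.mpr hn)
  -- the `I_f`-torsion `T`
  set T : Submodule ℤ (periodHomologyHecke N) :=
    (Submodule.torsionBySet (HeckeRing0 N 2) (periodHomologyHecke N) (heckeAnnihilator D.f : Set (HeckeRing0 N 2))).restrictScalars ℤ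
    with hTdef
  have hT : ∀ x, x ∈ T ↔ ∀ t ∈ heckeAnnihilator D.f, t • x = 0 := by
    intro x
    rw [hTdef, Submodule.restrictScalars_mem, Submodule.mem_torsionBySet_iff]
    exact ⟨fun h t ht ↦ h ⟨t, ht⟩, fun h t ↦ h t t.2⟩
  have hIK : ∀ t ∈ heckeAnnihilator D.f, ∀ y : periodHomologyHecke N, t • y ∈ K := by
    intro t ht y
    rw [hKmem, Submodule.coe_smul, HeckeRing0.smul_dual_apply]
    have : HeckeRing0.toEnd N 2 t D.f = 0 := ht
    rw [this, map_zero]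
  -- ranks
  have hrankK : Module.finrank ℤ (periodHomologyHecke N ⧸ K) = 2 := finrank_quotient_evalKer D g hg hc θ hθ hθs
  have hrank : Module.finrank ℤ T ≤ Module.finrank ℤ (periodHomologyHecke N ⧸ K) := by rw [hrankK]; exact hR2
  -- the half-class kernel is `K + 2Λ`
  have hθK : ∀ k ∈ K, θ k = 0 := fun k hk ↦
    (hθ k).mpr (jacobiMap_half_eq_zero_of_mem_add_two D (k := k) (z := 0) ((hKmem k).mp hk) (by rw [smul_zero, add_zero]))
  have hker : D.jacobiMap (Submodule.Quotient.mk ((2 : ℂ)⁻¹ • (y : Module.Dual ℂ (CuspForm (Gamma0 N) 2)))) = 0 ↔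
      ∃ k ∈ K, ∃ z : periodHomologyHecke N, y = k + (2 : ℤ) • z := by
    constructor
    · intro hy
      have hθy : θ y = 0 := (hθ y).mpr hy
      have hcard : Nat.card (geomTorsion W (2 : ℤ)) = 2 ^ Module.finrank ℤ (periodHomologyHecke N ⧸ K) := by
        rw [hrankK, Summit.BirchSwinnertonDyer.BirchSwinnertonDyer.Theorems.AlignedTransportAtTwoRhombicOfNegDisc.natCard_geomTorsion_two]; norm_num
      obtain ⟨k, hk, z, hz⟩ := exists_mem_add_smul_of_apply_eq_zero K hKsat 2 two_nsmul_geomTorsion_two θ hθK hθs hcard hθy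
      exact ⟨k, hk, z, by rw [hz]; norm_num⟩
    · rintro ⟨k, hk, z, hz⟩
      exact jacobiMap_half_eq_zero_of_mem_add_two D ((hKmem k).mp hk) hz
  rw [hker, mem_add_smul_iff_forall_dvd B hB hadj T hT K hIK hKsat hrank 2 y]
  exact ⟨fun h x hx ↦ h x ((hT x).mpr hx), fun h x hx ↦ h x ((hT x).mp hx)⟩

/-! ## §4 SAME COPY ⟹ SAME KERNEL -/

/-- **Equal copies have equal orthogonals.** If `twoTorsionCopy f₁ = twoTorsionCopy f₂` in `J₀(N)[2]`, then for every `y ∈ Λ`: `B(x, y)` is even for all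
`I_{f₁}`-torsion `x` iff it is even for all `I_{f₂}`-torsion `x` (an `x₁ ∈ Λ[I₁]` has `[x₁/2] = [x₂/2]` for some `x₂ ∈ Λ[I₂]`, i.e. `x₁ − x₂ ∈ 2Λ`).
[folklore] -/
theorem forall_dvd_iff_of_twoTorsionCopy_eq (B : periodHomologyHecke N →+ periodHomologyHecke N →+ ℤ)
    {f₁ f₂ : CuspForm (Gamma0 N) 2} (h : twoTorsionCopy f₁ = twoTorsionCopy f₂) (y : periodHomologyHecke N) :
    (∀ x : periodHomologyHecke N, (∀ t ∈ heckeAnnihilator f₁, t • x = 0) → (2 : ℤ) ∣ B x y) ↔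
      (∀ x : periodHomologyHecke N, (∀ t ∈ heckeAnnihilator f₂, t • x = 0) → (2 : ℤ) ∣ B x y) := by
  -- one direction suffices by symmetry
  suffices key : ∀ {g₁ g₂ : CuspForm (Gamma0 N) 2}, twoTorsionCopy g₁ = twoTorsionCopy g₂ →
      (∀ x : periodHomologyHecke N, (∀ t ∈ heckeAnnihilator g₁, t • x = 0) → (2 : ℤ) ∣ B x y) →
      ∀ x : periodHomologyHecke N, (∀ t ∈ heckeAnnihilator g₂, t • x = 0) → (2 : ℤ) ∣ B x y from
    ⟨key h, key h.symm⟩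
  intro g₁ g₂ hg h₁ x₂ hx₂
  -- `[x₂/2]` lies in the copy of `g₂`, hence in the copy of `g₁`
  have hx₂' : (⟨(x₂ : Module.Dual ℂ (CuspForm (Gamma0 N) 2)), x₂.2⟩ : periodHomology N) ∈ isotypicPeriodSublattice g₂ := by
    change ∀ t ∈ heckeAnnihilator g₂, t • (x₂ : Module.Dual ℂ (CuspForm (Gamma0 N) 2)) = 0
    intro t ht
    have := hx₂ t ht
    rw [← Subtype.coe_inj, Submodule.coe_smul, Submodule.coe_zero] at this
    exact this
  have hmem : J0.divMap N 2 ⟨(x₂ : Module.Dual ℂ (CuspForm (Gamma0 N) 2)), x₂.2⟩ ∈ twoTorsionCopy g₁ := by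
    rw [hg]; exact ⟨_, hx₂', rfl⟩
  obtain ⟨x₁, hx₁, hx₁₂⟩ := hmem
  -- `x₁ − x₂ ∈ 2Λ`
  have hdiff : (2 : ℂ)⁻¹ • ((x₁ : Module.Dual ℂ (CuspForm (Gamma0 N) 2)) - (x₂ : Module.Dual ℂ (CuspForm (Gamma0 N) 2))) ∈
      periodHomologyHecke N := by
    rw [smul_sub, ← Submodule.Quotient.eq]
    exact hx₁₂
  set w : periodHomologyHecke N := ⟨_, hdiff⟩ with hw
  let x₁' : periodHomologyHecke N := ⟨(x₁ : Module.Dual ℂ (CuspForm (Gamma0 N) 2)), x₁.2⟩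
  have hx₁T : ∀ t ∈ heckeAnnihilator g₁, t • x₁' = 0 := by
    intro t ht
    apply Subtype.ext
    rw [Submodule.coe_smul, Submodule.coe_zero]
    exact hx₁ t ht
  have hdecomp : x₂ = x₁' - (2 : ℤ) • w := by
    apply Subtype.ext
    change (x₂ : Module.Dual ℂ (CuspForm (Gamma0 N) 2)) = (x₁ : Module.Dual ℂ (CuspForm (Gamma0 N) 2)) -
      (2 : ℤ) • ((2 : ℂ)⁻¹ • ((x₁ : Module.Dual ℂ (CuspForm (Gamma0 N) 2)) - (x₂ : Module.Dual ℂ (CuspForm (Gamma0 N) 2))))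
    rw [← Int.cast_smul_eq_zsmul ℂ, smul_smul, Int.cast_ofNat, mul_inv_cancel₀ (two_ne_zero : (2 : ℂ) ≠ 0), one_smul,
      sub_sub_cancel]
  rw [hdecomp, map_sub, map_zsmul, AddMonoidHom.sub_apply, AddMonoidHom.zsmul_apply, smul_eq_mul]
  exact dvd_sub (h₁ x₁' hx₁T) (dvd_mul_right 2 _)

/-- **SAME COPY ⟹ SAME KERNEL** — the hypothesis `hker` of the (R2) capstones (`…KilfordCopyNegDisc.lamLawKilford_of_conductorNorm_eq_of_ker_iff`,
`…KilfordCopyTransport.jacobiMap_half_transport_of_ker_iff`) from the equality of the cell's copies `twoTorsionCopy D₁.f = twoTorsionCopy D₂.f`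
(the conclusion of `F1Sign2.CopyAlignmentAtTwo`), given IP, a carrier `J`, both Jacobi maps non-zero on some half-class, and RANK2 for both newforms.
[cite: DarmonDiamondTaylor1995, §1.6 Lemma 1.38 and §1.7] [cite: KilfordWiese2008, Question 1.9] -/
theorem ker_iff_of_twoTorsionCopy_eq (hIP : periodHomology_exists_heckeSelfAdjoint_perfectPairing)
    (ι : AlgebraicClosure ℚ →+* ℂ) (J : ModularJacobianGaloisData N ι)
    {W₁ W₂ : WeierstrassCurve ℚ} [W₁.IsElliptic] [W₂.IsElliptic]
    (D₁ : ModularParametrizationData W₁ N) (D₂ : ModularParametrizationData W₂ N)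
    (ht₁ : ∀ x : ℚ, ¬ HasRationalTwoTorsionX W₁ x) (ht₂ : ∀ x : ℚ, ¬ HasRationalTwoTorsionX W₂ x)
    (hnz₁ : ∃ x ∈ periodHomology N, D₁.jacobiMap (Submodule.Quotient.mk ((2 : ℂ)⁻¹ • x)) ≠ 0)
    (hnz₂ : ∃ x ∈ periodHomology N, D₂.jacobiMap (Submodule.Quotient.mk ((2 : ℂ)⁻¹ • x)) ≠ 0)
    (hR2₁ : Module.finrank ℤ
      ((Submodule.torsionBySet (HeckeRing0 N 2) (periodHomologyHecke N) (heckeAnnihilator D₁.f : Set (HeckeRing0 N 2))).restrictScalars ℤ) ≤ 2)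
    (hR2₂ : Module.finrank ℤ
      ((Submodule.torsionBySet (HeckeRing0 N 2) (periodHomologyHecke N) (heckeAnnihilator D₂.f : Set (HeckeRing0 N 2))).restrictScalars ℤ) ≤ 2)
    (hcopy : twoTorsionCopy D₁.f = twoTorsionCopy D₂.f) :
    ∀ x ∈ periodHomology N,
      D₁.jacobiMap (Submodule.Quotient.mk ((2 : ℂ)⁻¹ • x)) = 0 ↔ D₂.jacobiMap (Submodule.Quotient.mk ((2 : ℂ)⁻¹ • x)) = 0 := by
  intro x hx
  obtain ⟨B, hB, hadj⟩ := hIP N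
  have h₁ := jacobiMap_half_eq_zero_iff_forall_dvd B hB hadj ι J D₁ ht₁ hnz₁ hR2₁ ⟨x, hx⟩
  have h₂ := jacobiMap_half_eq_zero_iff_forall_dvd B hB hadj ι J D₂ ht₂ hnz₂ hR2₂ ⟨x, hx⟩
  exact (h₁.trans (forall_dvd_iff_of_twoTorsionCopy_eq B hcopy ⟨x, hx⟩)).trans h₂.symm

end Summit.BirchSwinnertonDyer.BirchSwinnertonDyer.Theorems.AlignedTransportAtTwoKilfordCopyKernel

end
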